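import Summits.CriticalPhenomena.PercolationContinuityZ3.Theorems.PercTreeValueConnectionPatternFactorisation
import Literature.Probability.Percolation.BernoulliPercolationProofs
import Literature.Probability.Percolation.TwoPointFunction
import HarnessLib

/-!
# Stub `stub_anchor` of line `Sketch` for the crux `PercTreeValue.EquilateralAntiFactorisation`

The ANCHOR of the pivotal-deficit flow: at every supercritical parameter `p₁ > p_c(ℤ³)` the
Delfino–Viti ratio of the equilateral lattice triangle `{0, a_r, b_r}`, `a_r = (r,r,0)`,
`b_r = (r,0,r)`,

`R_r(p₁)² = P_{p₁}(0 ↔ a_r ∧ 0 ↔ b_r)² / (τ(0,a_r) τ(a_r,b_r) τ(b_r,0))`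

tends to `1` as `r → ∞`.

Argument (pure limit bookkeeping, copied from the assembly `AssemblyViaThreePoint`): above `p_c`
the percolation probability `θ := θ(p₁)` is positive (`theta_pos_of_criticalProb_lt_holds`), and
pattern-blindness (the route's proved support item `connectionPatternFactorisation_proof`) applied
at `p = p₁` with `k = 3`, pattern `{(0,1),(0,2)}` on `A_n = (0, a_n, b_n)` gives
`P(0 ↔ a_n ∧ 0 ↔ b_n) → θ³`, and with `k = 2`, pattern `{(0,1)}` on the pairs `(0,a_n)`, `(a_n,b_n)`,
`(b_n,0)` gives each `τ → θ²`. Hence the ratio tends to `(θ³)² / (θ² θ² θ²) = 1`.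
-/

noncomputable section

namespace Summit.CriticalPhenomena.PercolationContinuityZ3.Theorems.EquilateralAntiFactorisation

open MeasureTheory Filter Topology
open Literature.Probability.Percolation Literature.Probability.LatticeModels

namespace Anchor

/-- A sequence of lattice points one of whose coordinates has absolute value `n` at time `n`
tends to infinity in the sup norm. -/
theorem tendsto_norm_of_coord (l : Fin 3) (f : ℕ → Site 3) (hf : ∀ n : ℕ, ‖f n l‖ = (n : ℝ)) :
    Tendsto (fun n => ‖f n‖) atTop atTop := by
  refine tendsto_atTop_mono (fun n => ?_) tendsto_natCast_atTop_atTop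
  rw [← hf n]
  exact norm_le_pi_norm (f n) l

/-- Pattern-blindness on the face: `P_p(0 ↔ a_r ∧ 0 ↔ b_r) → θ(p)³` (the `3`-point configuration
`(0, a_n, b_n)` with pattern `{(0,1),(0,2)}`; a local term, no definition introduced). -/
theorem tendsto_threePoint (p : unitInterval) :
    Tendsto (fun r : ℕ => (bondPercolation (zdGraph 3) p).real
        (openConn (0 : Site 3) ![(r : ℤ), (r : ℤ), 0] ∩ openConn (0 : Site 3) ![(r : ℤ), 0, (r : ℤ)]))
      atTop (𝓝 (theta (zdGraph 3) 0 p ^ 3)) := by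
  have hF := Summit.CriticalPhenomena.PercolationContinuityZ3.Theorems.connectionPatternFactorisation_proof
  unfold Summit.CriticalPhenomena.PercolationContinuityZ3.Theses.PercTreeValue.ConnectionPatternFactorisation
    at hF
  let cfgT : ℕ → Fin 3 → Site 3 := fun n =>
    ![(0 : Site 3), ![(n : ℤ), (n : ℤ), 0], ![(n : ℤ), 0, (n : ℤ)]]
  have hdist : ∀ i j : Fin 3, i ≠ j → Tendsto (fun n => ‖cfgT n i - cfgT n j‖) atTop atTop := by
    intro i j hij
    fin_cases i <;> fin_cases j <;> (first | exact absurd rfl hij | skip) <;>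
      first
        | (refine tendsto_norm_of_coord 0 _ (fun n => ?_); simp [cfgT]; done)
        | (refine tendsto_norm_of_coord 1 _ (fun n => ?_); simp [cfgT])
  have h3 := hF p 3 {((0 : Fin 3), (1 : Fin 3)), (0, 2)} (by decide) (by decide) cfgT hdist
  refine Tendsto.congr (fun r => ?_) h3
  simp [cfgT]

/-- Pattern-blindness on the edge `(0, a_r)`: `τ_p(0, a_r) → θ(p)²`. -/
theorem tendsto_tauA (p : unitInterval) :
    Tendsto (fun r : ℕ => tau 3 p 0 ![(r : ℤ), (r : ℤ), 0]) atTop (𝓝 (theta (zdGraph 3) 0 p ^ 2)) := by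
  have hF := Summit.CriticalPhenomena.PercolationContinuityZ3.Theorems.connectionPatternFactorisation_proof
  unfold Summit.CriticalPhenomena.PercolationContinuityZ3.Theses.PercTreeValue.ConnectionPatternFactorisation
    at hF
  let cfgA : ℕ → Fin 2 → Site 3 := fun n => ![(0 : Site 3), ![(n : ℤ), (n : ℤ), 0]]
  have hdist : ∀ i j : Fin 2, i ≠ j → Tendsto (fun n => ‖cfgA n i - cfgA n j‖) atTop atTop := by
    intro i j hij
    fin_cases i <;> fin_cases j <;> (first | exact absurd rfl hij | skip) <;>
      (refine tendsto_norm_of_coord 0 _ (fun n => ?_); simp [cfgA])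
  have h2 := hF p 2 {((0 : Fin 2), (1 : Fin 2))} (by decide) (by decide) cfgA hdist
  refine Tendsto.congr (fun r => ?_) h2
  simp [cfgA, tau_def]

/-- Pattern-blindness on the edge `(a_r, b_r)`: `τ_p(a_r, b_r) → θ(p)²`. -/
theorem tendsto_tauB (p : unitInterval) :
    Tendsto (fun r : ℕ => tau 3 p ![(r : ℤ), (r : ℤ), 0] ![(r : ℤ), 0, (r : ℤ)]) atTop
      (𝓝 (theta (zdGraph 3) 0 p ^ 2)) := by
  have hF := Summit.CriticalPhenomena.PercolationContinuityZ3.Theorems.connectionPatternFactorisation_proof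
  unfold Summit.CriticalPhenomena.PercolationContinuityZ3.Theses.PercTreeValue.ConnectionPatternFactorisation
    at hF
  let cfgB : ℕ → Fin 2 → Site 3 := fun n => ![![(n : ℤ), (n : ℤ), 0], ![(n : ℤ), 0, (n : ℤ)]]
  have hdist : ∀ i j : Fin 2, i ≠ j → Tendsto (fun n => ‖cfgB n i - cfgB n j‖) atTop atTop := by
    intro i j hij
    fin_cases i <;> fin_cases j <;> (first | exact absurd rfl hij | skip) <;>
      (refine tendsto_norm_of_coord 1 _ (fun n => ?_); simp [cfgB])
  have h2 := hF p 2 {((0 : Fin 2), (1 : Fin 2))} (by decide) (by decide) cfgB hdist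
  refine Tendsto.congr (fun r => ?_) h2
  simp [cfgB, tau_def]

/-- Pattern-blindness on the edge `(b_r, 0)`: `τ_p(b_r, 0) → θ(p)²`. -/
theorem tendsto_tauC (p : unitInterval) :
    Tendsto (fun r : ℕ => tau 3 p ![(r : ℤ), 0, (r : ℤ)] 0) atTop (𝓝 (theta (zdGraph 3) 0 p ^ 2)) := by
  have hF := Summit.CriticalPhenomena.PercolationContinuityZ3.Theorems.connectionPatternFactorisation_proof
  unfold Summit.CriticalPhenomena.PercolationContinuityZ3.Theses.PercTreeValue.ConnectionPatternFactorisation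
    at hF
  let cfgC : ℕ → Fin 2 → Site 3 := fun n => ![![(n : ℤ), 0, (n : ℤ)], (0 : Site 3)]
  have hdist : ∀ i j : Fin 2, i ≠ j → Tendsto (fun n => ‖cfgC n i - cfgC n j‖) atTop atTop := by
    intro i j hij
    fin_cases i <;> fin_cases j <;> (first | exact absurd rfl hij | skip) <;>
      (refine tendsto_norm_of_coord 0 _ (fun n => ?_); simp [cfgC])
  have h2 := hF p 2 {((0 : Fin 2), (1 : Fin 2))} (by decide) (by decide) cfgC hdist
  refine Tendsto.congr (fun r => ?_) h2
  simp [cfgC, tau_def]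

end Anchor

/-- **S6 (anchor).** For every supercritical `p₁ > p_c(ℤ³)` the squared Delfino–Viti ratio of the
equilateral lattice triangle, `P_{p₁}(0 ↔ a_r ∧ 0 ↔ b_r)² / (τ(0,a_r) τ(a_r,b_r) τ(b_r,0))` with
`a_r = (r,r,0)`, `b_r = (r,0,r)`, tends to `1` as `r → ∞`: `θ(p₁) > 0`
(`theta_pos_of_criticalProb_lt_holds`) and pattern-blindness
(`connectionPatternFactorisation_proof`) make the numerator tend to `(θ³)²` and the denominator
to `θ² θ² θ² ≠ 0`. -/
theorem stub_anchor (p₁ : unitInterval) (hp₁ : criticalProbI 3 < p₁) :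
    Tendsto (fun r : ℕ =>
      (bondPercolation (zdGraph 3) p₁).real (openConn (0 : Site 3) ![(r : ℤ), (r : ℤ), 0] ∩
          openConn (0 : Site 3) ![(r : ℤ), 0, (r : ℤ)]) ^ 2 /
        (tau 3 p₁ 0 ![(r : ℤ), (r : ℤ), 0] * tau 3 p₁ ![(r : ℤ), (r : ℤ), 0] ![(r : ℤ), 0, (r : ℤ)] *
          tau 3 p₁ ![(r : ℤ), 0, (r : ℤ)] 0))
      atTop (𝓝 1) := by
  -- θ := θ(p₁) > 0 above `p_c`
  have hp₁' : criticalProb (zdGraph 3) (0 : Site 3) < (p₁ : ℝ) := by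
    rw [← coe_criticalProbI]
    exact Subtype.coe_lt_coe.mpr hp₁
  have hθpos : 0 < theta (zdGraph 3) (0 : Site 3) p₁ :=
    theta_pos_of_criticalProb_lt_holds (zdGraph 3) (0 : Site 3) p₁ hp₁'
  have hθne : theta (zdGraph 3) (0 : Site 3) p₁ ≠ 0 := ne_of_gt hθpos
  have hden : theta (zdGraph 3) (0 : Site 3) p₁ ^ 2 * theta (zdGraph 3) (0 : Site 3) p₁ ^ 2 *
      theta (zdGraph 3) (0 : Site 3) p₁ ^ 2 ≠ 0 := by positivity
  have hval : (theta (zdGraph 3) (0 : Site 3) p₁ ^ 3) ^ 2 /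
      (theta (zdGraph 3) (0 : Site 3) p₁ ^ 2 * theta (zdGraph 3) (0 : Site 3) p₁ ^ 2 *
        theta (zdGraph 3) (0 : Site 3) p₁ ^ 2) = 1 := by
    rw [div_eq_one_iff_eq hden]
    ring
  have h := ((Anchor.tendsto_threePoint p₁).pow 2).div
    (((Anchor.tendsto_tauA p₁).mul (Anchor.tendsto_tauB p₁)).mul (Anchor.tendsto_tauC p₁)) hden
  rw [hval] at h
  exact h

end Summit.CriticalPhenomena.PercolationContinuityZ3.Theorems.EquilateralAntiFactorisation

end
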